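import Literature.NumberTheory.Transcendental.ZilberFieldHomogeneity
import Literature.NumberTheory.Transcendental.EclWeakSchanuelProofs
import Literature.NumberTheory.Transcendental.AxSchanuelUniv
import Literature.NumberTheory.Transcendental.ZilberProp112
import HarnessLib

/-!
# `ecl`-closed sets are Γ-closed in every universe (discharge of `Kirby2010_isGammaClosed_ecl`)

Proofs file for the named fact `Literature.NumberTheory.Transcendental.Kirby2010_isGammaClosed_ecl`
of `ZilberFieldHomogeneity.lean` (J. Kirby, *Exponential algebraicity in exponential fields*,
Bull. Lond. Math. Soc. 42 (2010), 879–890, Thm. 1.2: "Suppose `C ⊆ F` is `ecl^F`-closed. Let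
`x₁, …, xₙ ∈ F`. Then `δ(x̄/C) := td(x̄, exp(x̄)/C) - ldim_ℚ(x̄/C) ≥ dim^F(x̄/C)`"; M. Bays, J. Kirby,
Algebra & Number Theory 12 (2018), Remark 10.10: `ecl`-closed = `Γcl`-closed), which states: in
every exponential field `F : Type u` of characteristic zero and for every `C ⊆ F`, the subspace
`span ℚ (ecl C)` (`= ecl C`) is Γ-closed (`GammaField.IsGammaClosed`, Bays–Kirby Def. 4.9: a proper
finitely generated extension `ecl C + ℚx̄` has `δ(x̄/ecl C) ≥ 1`). This file DISCHARGES it: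
`Kirby2010_isGammaClosed_ecl_holds`.

The tree already proved the fact for fields `F : Type` (`Kirby2010_isGammaClosed_ecl_holds₀`, through
`GammaField.isGammaClosed_span_ecl` and `succ_le_relTrdeg_of_isEclClosed` of `GammaFieldsEcl.lean`),
the only obstruction to polymorphism being that those two theorems take Ax's theorem as the
hypothesis `hAx : Transcendental.ax_schanuel`, a named fact quantifying over `K : Type`, applied to
the subfield `L = ℚ(C)(x̄, e^{x̄})`. Ax's theorem is proved in every universe
(`Ax1971.add_rank_le_trdeg`, `AxSchanuelUniv.lean`, from Rosenlicht 1976 Prop. 4), and so is the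
`δ ≥ 0` form of Kirby's theorem (`card_le_relTrdeg_of_isEclClosed`, `EclWeakSchanuelProofs.lean`).
Here we re-run the two remaining proofs verbatim with these theorems in place of `hAx`:

* `card_succ_le_relTrdeg_of_isEclClosed` — Kirby 2010 Thm. 1.2 with the dimension term `≥ 1`
  (`n + 1 ≤ td(x̄, exp x̄/C)` for `C` `ecl`-closed, `n ≥ 1`, `x̄` independent modulo `C`), fields
  `K : Type u`, unconditionally: the proof of `succ_le_relTrdeg_of_isEclClosed` (Kirby's argument
  inside `L = ℚ(C)(x̄, e^{x̄})`: Khovanskii dichotomy, Lemma 4.8 / Prop. 7.1; a Khovanskii system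
  would put `x₁ ∈ ecl C = C`; otherwise a non-zero E-derivation `∂` of `L` over `C` with constants
  `E` splits `n = m + n'`, `m ≤ trdeg_C E` by the `δ ≥ 0` form for an integral basis `z̄` of
  `{q | q·x̄ ∈ E}`, and Ax 1971 Thm. 3 for `(L, ∂)` with rank term `rk(∂x̄') = 1` gives
  `n' + 1 ≤ trdeg_E L`; tower law), with `Ax1971.add_rank_le_trdeg` and
  `card_le_relTrdeg_of_isEclClosed` replacing the two uses of `hAx`.
* `GammaField.isGammaClosed_span_ecl_univ` — `span ℚ (ecl C)` is Γ-closed, `F : Type u`,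
  unconditionally (proof of `GammaField.isGammaClosed_span_ecl` verbatim);
  `GammaField.isStrong_span_ecl_univ` — hence strong.
* `Kirby2010_isGammaClosed_ecl_holds` — **the named fact HOLDS** in every universe.

No statement of an existing declaration is touched.

## References

* J. Kirby, *Exponential algebraicity in exponential fields*, Bull. Lond. Math. Soc. 42 (2010),
  879–890, arXiv:0810.4285, doi:10.1112/blms/bdq044: Thm. 1.2 (p. 3 of the arXiv version),
  Lemma 4.8, Thm. 5.1, Cor. 5.2, Prop. 7.1.
* J. Ax, *On Schanuel's conjectures*, Ann. of Math. 93 (1971), 252–268, Thm. 3.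
* M. Bays, J. Kirby, *Pseudo-exponential maps, variants, and quasiminimality*, Algebra & Number
  Theory 12 (2018), 493–549: Def. 4.9, Lemma 4.10, Remark 10.10.
-/

noncomputable section

open Set Cardinal MvPolynomial

universe u

namespace Literature.NumberTheory.Transcendental

/-! ### Kirby 2010, Thm 1.2 with the dimension term `≥ 1`, in every universe -/

section KirbySharpUniv

-- one long elementary argument, verbatim that of `succ_le_relTrdeg_of_isEclClosed` (fields in `Type`)
-- with the polymorphic Ax theorem `Ax1971.add_rank_le_trdeg` and `card_le_relTrdeg_of_isEclClosed`
set_option maxHeartbeats 400000 in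
/-- **Kirby 2010, Thm. 1.2 with the dimension term `≥ 1`, fields in any universe, unconditionally.**
If `C ⊆ K` is `ecl`-closed, `n ≥ 1` and `x : Fin n → K` is `ℚ`-linearly independent modulo `⟨C⟩_ℚ`,
then `n + 1 ≤ td(x̄, exp x̄ / C)`. Printed statement: "Suppose `C ⊆ F` is `ecl^F`-closed. Let
`x₁, …, xₙ ∈ F`. Then `td(x̄, exp(x̄)/C) - ldim_ℚ(x̄/C) ≥ dim^F(x̄/C)`", and `dim^F(x̄/C) ≥ 1`
because `x₁ ∉ C = ecl C`. Proof: that of `succ_le_relTrdeg_of_isEclClosed` (`GammaFieldsEcl.lean`,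
fields in `Type`, hypothesis `ax_schanuel`) — Kirby's proof of Thm. 1.2 / Prop. 7.1 run inside
`L = ℚ(C)(x̄, e^{x̄})` via the Khovanskii dichotomy, keeping the rank term of Ax's theorem: a
Khovanskii system would put `x₁ ∈ ecl C = C`; otherwise there is a non-zero E-derivation `∂` of `L`
over `C` with constants `E`, `n = m + n'` with `m < n`, `m ≤ trdeg_C E`
(`card_le_relTrdeg_of_isEclClosed` for an integral basis `z̄` of `{q | q·x̄ ∈ E}`), and Ax's theorem
(`Ax1971.add_rank_le_trdeg`, any universe) for `(L, ∂)` and a maximal sub-tuple `x̄'` of `x̄`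
independent modulo `E` gives `n' + rk(∂x̄') ≤ trdeg_E L` with `rk(∂x̄') = 1` (`∂x'ᵢ ≠ 0` as
`x'ᵢ ∉ E`, and `n' ≥ 1`); the tower law concludes. [cite: Kirby2010, Thm. 1.2 and Cor. 5.2] -/
theorem card_succ_le_relTrdeg_of_isEclClosed {K : Type u} [Field K] [CharZero K]
    [Literature.ModelTheory.ExponentialFields.ExponentialRing K]
    {C : Set K} (hC : IsEclClosed C) {n : ℕ} (hn : 0 < n)
    {x : Fin n → K} (hx : LinearIndependent ℚ ((Submodule.span ℚ C).mkQ ∘ x)) :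
    ((n + 1 : ℕ) : Cardinal) ≤ relTrdeg C x := by
  classical
  -- the base field `F = ℚ(C)` (`= C`) and the field `L = F(x̄, e^{x̄})`
  set F : IntermediateField ℚ K := IntermediateField.adjoin ℚ C with hF
  have hFC : ∀ c : F, (c : K) ∈ C := fun c => adjoin_rat_le_of_isEclClosed hC c.2
  set S : Set K := Set.range x ∪ Set.range (Literature.ModelTheory.ExponentialFields.ExponentialRing.exp ∘ x) with hS
  set L : IntermediateField F K := IntermediateField.adjoin F S with hL
  change ((n + 1 : ℕ) : Cardinal) ≤ Algebra.trdeg F L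
  have hxS : ∀ i, x i ∈ L := fun i => IntermediateField.subset_adjoin F S (Or.inl ⟨i, rfl⟩)
  have hyS : ∀ i, Literature.ModelTheory.ExponentialFields.ExponentialRing.exp (x i) ∈ L := fun i =>
    IntermediateField.subset_adjoin F S (Or.inr ⟨i, rfl⟩)
  set xL : Fin n → L := fun i => ⟨x i, hxS i⟩ with hxL
  set yL : Fin n → L := fun i => ⟨Literature.ModelTheory.ExponentialFields.ExponentialRing.exp (x i), hyS i⟩ with hyL
  have hy0 : ∀ i, yL i ≠ 0 := fun i h =>
    (Literature.ModelTheory.ExponentialFields.ExponentialRing.isUnit_exp (x i)).ne_zero (congrArg Subtype.val h)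
  have htopL : IntermediateField.adjoin F (Set.range xL ∪ Set.range yL) = ⊤ := by
    have h := IntermediateField.adjoin_preimage_val_eq_top (F := F) S
    have hpre : Set.range xL ∪ Set.range yL = ((↑) : L → K) ⁻¹' S := by
      ext t
      simp only [Set.mem_union, Set.mem_range, Set.mem_preimage, hS, Function.comp_apply]
      constructor
      · rintro (⟨i, rfl⟩ | ⟨i, rfl⟩)
        · exact Or.inl ⟨i, rfl⟩
        · exact Or.inr ⟨i, rfl⟩
      · rintro (⟨i, hi⟩ | ⟨i, hi⟩)
        · exact Or.inl ⟨i, Subtype.ext hi⟩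
        · exact Or.inr ⟨i, Subtype.ext hi⟩
    rw [hpre]
    exact h
  set zL : Fin n ⊕ Fin n → L := Sum.elim xL yL with hzL
  rcases khovanskii_dichotomy xL yL htopL with ⟨g, hg0, hdet⟩ | ⟨D, hDE, j₀, hj₀⟩
  · /- (a) `x̄` solves a Khovanskii system over `C`: impossible -/
    exfalso
    simp only [← hzL] at hg0 hdet
    have hkpt : Khovanskii.kpt x = algebraMap L K ∘ zL := by
      funext s; rcases s with i | i <;> rfl
    have heval : ∀ p : MvPolynomial (Fin n ⊕ Fin n) F,
        MvPolynomial.eval (Khovanskii.kpt x) (MvPolynomial.map (algebraMap F K) p) =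
          algebraMap L K (aeval zL p) := by
      intro p
      rw [MvPolynomial.eval_map, ← MvPolynomial.aeval_def, hkpt, MvPolynomial.aeval_algebraMap_apply]
    set f : Fin n → MvPolynomial (Fin n ⊕ Fin n) K := fun i => MvPolynomial.map (algebraMap F K) (g i)
      with hf
    have hsol : Khovanskii.IsSol C x f :=
      { coeff := fun i => Khovanskii.mem_polyOver_iff.mpr fun mo => by
          simp only [hf, MvPolynomial.coeff_map]
          exact Subring.subset_closure (hFC _)
        eval_eq := fun i => by
          simp only [hf]
          rw [heval, hg0 i, map_zero]
        det_ne := by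
          have hJ : Khovanskii.kjac x f =
              (algebraMap L K).mapMatrix (Matrix.of fun i j => aeval zL (Khovanskii.ePD j (g i))) := by
            ext i j
            simp only [Khovanskii.kjac, Matrix.of_apply, RingHom.mapMatrix_apply, Matrix.map_apply, hf]
            rw [Khovanskii.ePD_map, heval]
          rw [hJ, ← RingHom.map_det, map_ne_zero]
          exact hdet }
    have hmem : x ⟨0, hn⟩ ∈ ecl C :=
      Khovanskii.mem_ecl_iff.mpr ⟨Fin n, inferInstance, inferInstance, x, f, hsol, ⟨0, hn⟩, rfl⟩
    have hC' : ecl C = C := hC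
    rw [hC'] at hmem
    have h0 : ((Submodule.span ℚ C).mkQ ∘ x) ⟨0, hn⟩ = 0 := by
      simp only [Function.comp_apply, Submodule.mkQ_apply, Submodule.Quotient.mk_eq_zero]
      exact Submodule.subset_span hmem
    exact hx.ne_zero ⟨0, hn⟩ h0
  · /- (b) a non-zero E-derivation `D` of `L` over `F` -/
    -- `D` as a `ℤ`-derivation, its constants `CD`
    set Dz : Derivation ℤ L L := D.restrictScalars ℤ with hDz
    set D1 : Fin 1 → Derivation ℤ L L := fun _ => Dz with hD1
    set CD : Subring L := Transcendental.constantSubring D1 with hCD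
    have hmemCD : ∀ a : L, a ∈ CD ↔ D a = 0 := fun a => by
      simp only [hCD, hD1, hDz, Transcendental.mem_constantSubring, forall_const]
      exact Iff.rfl
    have hFCD : ∀ c : F, algebraMap F L c ∈ CD := fun c => (hmemCD _).mpr (D.map_algebraMap c)
    -- the elements of `L` killed by `D`, as a `ℚ`-subspace `N` of `K`
    set N : Submodule ℚ K := Submodule.restrictScalars ℚ
      ((LinearMap.ker (D : L →ₗ[F] L)).map (IsScalarTower.toAlgHom F L K).toLinearMap) with hN
    have hmemN : ∀ a : K, a ∈ N ↔ ∃ l : L, D l = 0 ∧ (l : K) = a := fun a => by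
      simp only [hN, Submodule.restrictScalars_mem, Submodule.mem_map, LinearMap.mem_ker]
      constructor
      · rintro ⟨l, hl, rfl⟩; exact ⟨l, hl, rfl⟩
      · rintro ⟨l, hl, rfl⟩; exact ⟨l, hl, rfl⟩
    -- the dependence space `V = {q ∈ ℚⁿ | q·x̄ ∈ N}` and the splitting `n = n' + m`
    set T : (Fin n → ℚ) →ₗ[ℚ] K := Fintype.linearCombination ℚ x with hT
    have hTapply : ∀ v : Fin n → ℚ, T v = ∑ i, v i • x i := fun v =>
      Fintype.linearCombination_apply ℚ x v
    set V : Submodule ℚ (Fin n → ℚ) := N.comap T with hV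
    set T' : (Fin n → ℚ) →ₗ[ℚ] K ⧸ N := N.mkQ ∘ₗ T with hT'
    have hker : LinearMap.ker T' = V := by rw [hT', LinearMap.ker_comp, Submodule.ker_mkQ]
    obtain ⟨κ, a, ha, hspan, hli⟩ := exists_linearIndependent' ℚ ((Submodule.mkQ N) ∘ x)
    haveI : Fintype κ := Fintype.ofInjective a ha
    set n' := Fintype.card κ with hn'
    set e := Fintype.equivFin κ with he
    have hrange : Module.finrank ℚ (LinearMap.range T') = n' := by
      have h1 : LinearMap.range T' = Submodule.span ℚ (Set.range (N.mkQ ∘ x)) := by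
        rw [hT', LinearMap.range_comp, hT, Fintype.range_linearCombination, Submodule.map_span,
          ← Set.range_comp]
      rw [h1, ← hspan, finrank_span_eq_card hli]
    set m := Module.finrank ℚ V with hm
    have hnm : n' + m = n := by
      have := LinearMap.finrank_range_add_finrank_ker T'
      rwa [hrange, hker, Module.finrank_fin_fun] at this
    have hmn : m < n := by
      by_contra hmn'
      have hmn2 : m = n := le_antisymm (by omega) (not_lt.mp hmn')
      have hVtop : V = ⊤ :=
        Submodule.eq_top_of_finrank_eq (by rw [← hm, hmn2, Module.finrank_fin_fun])
      have hmemV : (Pi.single j₀ (1 : ℚ) : Fin n → ℚ) ∈ V := hVtop ▸ Submodule.mem_top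
      rw [hV, Submodule.mem_comap, hT, Fintype.linearCombination_apply_single, one_smul] at hmemV
      obtain ⟨l, hl0, hl⟩ := (hmemN _).mp hmemV
      have hlx : l = xL j₀ := Subtype.ext hl
      rw [hlx] at hl0
      exact hj₀ hl0
    have hn'pos : 0 < n' := by omega
    -- Ax's theorem (with its rank term) for a maximal sub-tuple `x̄'` of `x̄` independent modulo `N`
    set x' : Fin n' → L := fun i => xL (a (e.symm i)) with hx'
    set y' : Fin n' → L := fun i => yL (a (e.symm i)) with hy'
    have hind : Transcendental.IsQLinearIndependentMod D1 x' := by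
      intro q hq
      have hD0 : D (∑ i, (q i : L) * x' i) = 0 := (hmemCD _).mp hq
      have hNmem : (∑ i, ((q i : ℚ)) • x (a (e.symm i))) ∈ N := by
        refine (hmemN _).mpr ⟨_, hD0, ?_⟩
        rw [show (∑ i, ((q i : ℚ)) • x (a (e.symm i))) = ∑ i, (q i : K) * x (a (e.symm i)) from
          Finset.sum_congr rfl fun i _ => by rw [Rat.smul_def, Rat.cast_intCast]]
        push_cast
        simp only [hx', hxL]
      have h0 : ∑ i, ((q i : ℤ) : ℚ) • ((N.mkQ ∘ x ∘ a) ∘ e.symm) i = 0 := by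
        have h1 : N.mkQ (∑ i, ((q i : ℚ)) • x (a (e.symm i))) = 0 :=
          (Submodule.Quotient.mk_eq_zero N).mpr hNmem
        rw [map_sum] at h1
        simpa only [map_smul, Function.comp_apply] using h1
      have hli' : LinearIndependent ℚ ((N.mkQ ∘ x ∘ a) ∘ e.symm) := hli.comp e.symm e.symm.injective
      have h2 := Fintype.linearIndependent_iff.mp hli' _ h0
      funext i
      exact_mod_cast h2 i
    have hAxL' := Ax1971.add_rank_le_trdeg D1 x' y' (fun i => hy0 _)
      (fun _ i => hDE (a (e.symm i))) hind
    -- the rank term is `≥ 1`: `D x'₀ ≠ 0` since `x'₀ ∉ N`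
    have hDx' : ∀ i, D (x' i) ≠ 0 := by
      intro i hDi
      have hmem : x (a (e.symm i)) ∈ N := (hmemN _).mpr ⟨x' i, hDi, rfl⟩
      have hli' : LinearIndependent ℚ ((N.mkQ ∘ x ∘ a) ∘ e.symm) := hli.comp e.symm e.symm.injective
      apply hli'.ne_zero i
      simp only [Function.comp_apply, Submodule.mkQ_apply, Submodule.Quotient.mk_eq_zero]
      exact hmem
    have hrank : 1 ≤ (Matrix.of fun i j => D1 j (x' i)).rank := by
      set A := (Matrix.of fun i j => D1 j (x' i)) with hA
      let i₀ : Fin n' := ⟨0, hn'pos⟩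
      let B : Matrix Unit Unit L := A.submatrix (fun _ => i₀) (fun _ => (0 : Fin 1))
      have hBdet : B.det = D (x' i₀) := by
        rw [Matrix.det_unique]
        simp [B, hA, hD1, hDz]
      have hB : B.rank = 1 := by
        rw [Matrix.rank_of_isUnit B ((Matrix.isUnit_iff_isUnit_det B).2
          (by rw [hBdet]; exact isUnit_iff_ne_zero.2 (hDx' i₀))), Fintype.card_unit]
      calc 1 = B.rank := hB.symm
        _ ≤ A.rank := Matrix.rank_submatrix_le A _ _
    have hAxL := le_trans (Nat.cast_le.mpr (Nat.add_le_add_left hrank n')) hAxL'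
    letI algCD : Algebra CD L := Algebra.ofSubsemiring CD
    have h1 : ((n' + 1 : ℕ) : Cardinal) ≤ Algebra.trdeg CD L :=
      hAxL.trans (trdeg_le_of_injective (Subalgebra.val _) Subtype.val_injective)
    -- an integral basis of `V` and the tuple `z̄`
    let bV := Module.finBasis ℚ V
    have hint : ∀ k : Fin m, ∃ d : ℕ, d ≠ 0 ∧ ∃ w : Fin n → ℤ,
        ∀ i, (d : ℚ) * ((bV k : V) : Fin n → ℚ) i = w i := fun k => exists_nat_mul_eq_intCast _
    choose d hd w hw using hint
    have huV : ∀ k, (fun i => (w k i : ℚ)) ∈ V := fun k => by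
      have : (fun i => (w k i : ℚ)) = (d k : ℚ) • ((bV k : V) : Fin n → ℚ) := by
        funext i; rw [Pi.smul_apply, smul_eq_mul, hw]
      rw [this]
      exact V.smul_mem _ (bV k).2
    have hli_u : LinearIndependent ℚ (fun k => fun i => (w k i : ℚ)) := by
      have hb : LinearIndependent ℚ (fun k => ((bV k : V) : Fin n → ℚ)) :=
        bV.linearIndependent.map' V.subtype (Submodule.ker_subtype V)
      have hb2 := hb.units_smul fun k => Units.mk0 (d k : ℚ) (Nat.cast_ne_zero.mpr (hd k))
      convert hb2 using 1
      funext k i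
      change (w k i : ℚ) = ((Units.mk0 (d k : ℚ) (Nat.cast_ne_zero.mpr (hd k))) •
        ((bV k : V) : Fin n → ℚ)) i
      rw [Units.smul_def, Units.val_mk0, Pi.smul_apply, smul_eq_mul, hw]
    set z : Fin m → K := fun k => ∑ i, (w k i : K) * x i with hz
    -- `z̄` is independent modulo `C`
    have hzind : LinearIndependent ℚ ((Submodule.span ℚ C).mkQ ∘ z) := by
      rw [Fintype.linearIndependent_iff]
      intro c hc
      have hc1 : ∑ i, (∑ k, c k * (w k i : ℚ)) • ((Submodule.span ℚ C).mkQ ∘ x) i = 0 := by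
        rw [← hc]
        simp only [Function.comp_apply, hz, map_sum, Finset.smul_sum, Finset.sum_smul, mul_smul]
        rw [Finset.sum_comm]
        refine Finset.sum_congr rfl fun k _ => Finset.sum_congr rfl fun i _ => ?_
        rw [← map_smul, ← map_smul, ← map_smul, Rat.smul_def (w k i : ℚ), Rat.cast_intCast]
      have hc2 := Fintype.linearIndependent_iff.mp hx _ hc1
      have hc3 : ∑ k, c k • (fun i => (w k i : ℚ)) = 0 := by
        funext i
        rw [Finset.sum_apply, Pi.zero_apply]
        simpa only [Pi.smul_apply, smul_eq_mul] using hc2 i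
      exact Fintype.linearIndependent_iff.mp hli_u c hc3
    -- `z_k ∈ L` and `e^{z_k} ∈ L` are killed by `D`
    set zLk : Fin m → L := fun k => ∑ i, (w k i : L) * xL i with hzLk
    have hzcoe : ∀ k, ((zLk k : L) : K) = z k := fun k => by
      simp only [hzLk, hz, hxL]
      push_cast
      rfl
    have hDz0 : ∀ k, D (zLk k) = 0 := fun k => by
      obtain ⟨l, hl0, hl⟩ := (hmemN _).mp (Submodule.mem_comap.mp (huV k))
      have hTz : T (fun i => (w k i : ℚ)) = z k := by
        rw [hTapply, hz]
        exact Finset.sum_congr rfl fun i _ => by rw [Rat.smul_def, Rat.cast_intCast]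
      have hl' : l = zLk k := Subtype.ext (by rw [hl, hTz, hzcoe])
      rw [← hl']
      exact hl0
    set ezLk : Fin m → L := fun k => ∏ i, yL i ^ w k i with hezLk
    have hezcoe : ∀ k, ((ezLk k : L) : K) = Literature.ModelTheory.ExponentialFields.ExponentialRing.exp (z k) := fun k => by
      rw [hz]
      dsimp only
      rw [exp_sum_intCast_mul]
      simp only [hezLk, hyL]
      push_cast
      rfl
    have hDez0 : ∀ k, D (ezLk k) = 0 := fun k => by
      simp only [hezLk]
      rw [derivation_prod_zpow_of_exp D xL yL hy0 hDE (w k)]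
      have : D (∑ i, (w k i : L) * xL i) = 0 := hDz0 k
      rw [this, mul_zero]
    -- the weak form (`δ ≥ 0`) for `z̄` (proved in every universe: `card_le_relTrdeg_of_isEclClosed`)
    have hIH : (m : Cardinal) ≤ relTrdeg C z := card_le_relTrdeg_of_isEclClosed hC m z hzind
    set Sz : Set K := Set.range z ∪ Set.range (Literature.ModelTheory.ExponentialFields.ExponentialRing.exp ∘ z) with hSz
    set Nz : IntermediateField F K := IntermediateField.adjoin F Sz with hNz
    change (m : Cardinal) ≤ Algebra.trdeg F Nz at hIH
    have hle : Nz ≤ L := by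
      rw [hNz, IntermediateField.adjoin_le_iff]
      rintro t (⟨k, rfl⟩ | ⟨k, rfl⟩)
      · rw [← hzcoe]; exact (zLk k).2
      · simp only [Function.comp_apply]; rw [← hezcoe]; exact (ezLk k).2
    have hιE : ∀ (t : K) (ht : t ∈ Nz), (⟨t, hle ht⟩ : L) ∈ CD := by
      intro t ht
      rw [hmemCD]
      induction ht using IntermediateField.adjoin_induction with
      | mem t ht =>
        rcases ht with ⟨k, rfl⟩ | ⟨k, rfl⟩
        · have h' : (⟨z k, hle (IntermediateField.subset_adjoin F Sz (Or.inl ⟨k, rfl⟩))⟩ : L) =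
              zLk k := Subtype.ext (hzcoe k).symm
          rw [h']; exact hDz0 k
        · have h' : (⟨(Literature.ModelTheory.ExponentialFields.ExponentialRing.exp ∘ z) k,
              hle (IntermediateField.subset_adjoin F Sz (Or.inr ⟨k, rfl⟩))⟩ : L) = ezLk k :=
            Subtype.ext (hezcoe k).symm
          rw [h']; exact hDez0 k
      | algebraMap c => exact D.map_algebraMap c
      | add s t hs ht ihs iht =>
        have h' : (⟨s + t, hle (add_mem hs ht)⟩ : L) = ⟨s, hle hs⟩ + ⟨t, hle ht⟩ := rfl
        rw [h', map_add, ihs, iht, add_zero]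
      | inv s hs ihs =>
        have h' : (⟨s⁻¹, hle (inv_mem hs)⟩ : L) = (⟨s, hle hs⟩)⁻¹ := rfl
        rw [h', Derivation.leibniz_inv, ihs, smul_zero]
      | mul s t hs ht ihs iht =>
        have h' : (⟨s * t, hle (mul_mem hs ht)⟩ : L) = ⟨s, hle hs⟩ * ⟨t, hle ht⟩ := rfl
        rw [h', Derivation.leibniz, ihs, iht, smul_zero, smul_zero, add_zero]
    -- assembling: `n + 1 = m + (n' + 1) ≤ trdeg_F Nz + trdeg_CD L ≤ trdeg_F L`
    have htower := trdeg_add_le_of_le_subring L Nz hle CD hFCD hιE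
    calc ((n + 1 : ℕ) : Cardinal) = (m : Cardinal) + ((n' + 1 : ℕ) : Cardinal) := by
          rw [← hnm]; push_cast; ring
      _ ≤ Algebra.trdeg F Nz + Algebra.trdeg CD L := add_le_add hIH h1
      _ ≤ Algebra.trdeg F L := htower

end KirbySharpUniv

namespace GammaField

open Literature.ModelTheory.ExponentialFields.ExponentialRing

section EclGammaClosedUniv

variable {F : Type u} [Field F] [CharZero F] [Literature.ModelTheory.ExponentialFields.ExponentialRing F]

/-! ### `ecl`-closed sets are Γ-closed, in every universe -/

/-- **`ecl`-closed sets are Γ-closed, fields in any universe, unconditionally** (Bays–Kirby 2018,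
Remark 10.10, "`ecl`-closed = `Γcl`-closed [EAEF]", in the direction used in §11: for `H = ecl H`
and a proper finitely generated extension `H + ℚx̄`, `δ(x̄/H) ≥ 1`), via Kirby 2010 Thm 1.2 with
`dim^F(x̄/H) ≥ 1` (`card_succ_le_relTrdeg_of_isEclClosed`). The proof is that of
`GammaField.isGammaClosed_span_ecl` (`GammaFieldsEcl.lean`, fields in `Type`, hypothesis
`ax_schanuel`) verbatim. [cite: Kirby2010, Thm. 1.2] [cite: BaysKirby2018ANT, Remark 10.10] -/
theorem isGammaClosed_span_ecl_univ (C : Set F) :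
    IsGammaClosed (Submodule.span ℚ (ecl C)) := by
  classical
  set Λ := Submodule.span ℚ (ecl C) with hΛ
  intro Λ' hle hfg hδ
  by_contra hne
  haveI := hfg.finite
  -- a `ℚ`-basis of `Λ'` modulo `Λ`, lifted to `Λ'`
  set n := ldim Λ Λ' with hn
  have hn0 : n ≠ 0 := by
    rw [hn, Ne, ldim_eq_zero_iff hfg]
    exact fun h => hne (le_antisymm h hle)
  let b := Module.finBasis ℚ ↥(Λ'.map Λ.mkQ)
  have hcard : Module.finrank ℚ ↥(Λ'.map Λ.mkQ) = n := rfl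
  have hmem : ∀ i : Fin n, ∃ y ∈ Λ', Λ.mkQ y = (b (Fin.cast hcard.symm i) : F ⧸ Λ) := fun i =>
    Submodule.mem_map.1 (b (Fin.cast hcard.symm i)).2
  choose x hxΛ' hxb using hmem
  -- `x` is linearly independent modulo `Λ = span (ecl C)`
  have hx : LinearIndependent ℚ ((Submodule.span ℚ (ecl C)).mkQ ∘ x) := by
    have hb : LinearIndependent ℚ
        (fun i : Fin n => ((b (Fin.cast hcard.symm i) : ↥(Λ'.map Λ.mkQ)) : F ⧸ Λ)) :=
      (b.linearIndependent.map' (Λ'.map Λ.mkQ).subtype (Submodule.ker_subtype _)).comp _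
        (Fin.cast_injective _)
    convert hb using 1
    funext i
    exact hxb i
  -- Kirby's inequality (`n ≥ 1`) and the bridge to `td`
  have hK := card_succ_le_relTrdeg_of_isEclClosed (isEclClosed_ecl C) (Nat.pos_of_ne_zero hn0) hx
  have h1 : ((n + 1 : ℕ) : ℕ∞) ≤ (algMatroid F).relRank (ecl C) (range x ∪ range (exp ∘ x)) := by
    have := (OrderHomClass.mono Cardinal.toENat hK).trans (toENat_relTrdeg_le_relRank (ecl C) x)
    rwa [map_natCast] at this
  have h2 : (algMatroid F).relRank (ecl C) (range x ∪ range (exp ∘ x)) ≤ td Λ Λ' := by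
    rw [← td_span_ecl_span_eq]
    calc td Λ (Submodule.span ℚ (range x)) = td Λ (Λ ⊔ Submodule.span ℚ (range x)) :=
          (td_sup_left _ _).symm
      _ ≤ td Λ Λ' := td_mono Λ (sup_le hle (Submodule.span_le.2 (range_subset_iff.2 hxΛ')))
  have h3 : n + 1 ≤ (td Λ Λ').toNat := by
    have hne' : td Λ Λ' ≠ ⊤ := td_ne_top hfg
    have := h1.trans h2
    rw [← ENat.coe_toNat hne'] at this
    exact_mod_cast this
  have h4 : predim Λ Λ' = ((td Λ Λ').toNat : ℤ) - (n : ℤ) := rfl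
  omega

/-- `ecl`-closed sets are strong in every universe: `δ(x̄/ecl C) ≥ 0` (Kirby 2010 Thm 1.2 in the
form `≥ 0`; Bays–Kirby 2018 Lemma 4.10 (1)). [cite: Kirby2010, Thm. 1.2] -/
theorem isStrong_span_ecl_univ (C : Set F) : IsStrong (Submodule.span ℚ (ecl C)) :=
  (isGammaClosed_span_ecl_univ C).isStrong

end EclGammaClosedUniv

end GammaField

/-! ### The discharge -/

/-- **The named fact `Kirby2010_isGammaClosed_ecl` HOLDS** (Kirby 2010, Thm. 1.2; Bays–Kirby 2018,
Remark 10.10): in every exponential field `F : Type u` of characteristic zero, in every universe,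
and for every `C ⊆ F`, the subspace `span ℚ (ecl C)` is Γ-closed
(`GammaField.isGammaClosed_span_ecl_univ`; the instance `F : Type` was
`Kirby2010_isGammaClosed_ecl_holds₀`). [cite: Kirby2010, Thm. 1.2] [cite: BaysKirby2018ANT, Remark 10.10] -/
theorem Kirby2010_isGammaClosed_ecl_holds : Kirby2010_isGammaClosed_ecl.{u} :=
  fun C => GammaField.isGammaClosed_span_ecl_univ C

end Literature.NumberTheory.Transcendental

end

/-!
# Part II. `ℵ₀`-saturation of Zilber fields for Γ-algebraic extensions over `ℚτ` (Bays–Kirby 2018, Lemma 8.3)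

Proofs towards the second named fact
`Literature.NumberTheory.Transcendental.BaysKirby2018_saturation_of_isStronglyExpAlgClosed` of
`ZilberFieldHomogeneity.lean` (M. Bays, J. Kirby, *Pseudo-exponential maps, variants, and
quasiminimality*, Algebra & Number Theory 12 (2018), Lemma 8.3 (⟹) with Def. 5.14, in the
setting of Thm 9.1: base `F_base = ℚ^{ab}(τ)`, `ker exp = τℤ`): strong exponential-algebraic
closedness makes an algebraically closed exponential field with `exp` onto `Fˣ` and
`ker exp = τℤ` `ℵ₀`-saturated for finitely generated Γ-algebraic strong extensions of the strong
subspaces `ℚτ + ℚc ◁ F`.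

Main result: `Literature.NumberTheory.Transcendental.BaysKirby2018_saturation_of_isStronglyExpAlgClosed_of_divisionSequences_determined`
— the fact **follows from** the Kummer-theoretic named fact
`Literature.FieldTheory.Kummer.BaysKirby2018_divisionSequences_determined` (Bays–Kirby 2018,
Prop. 3.22 with Prop. 3.24: division sequences below a good division point are determined; the
Thumbtack Lemma). That arithmetic input is genuinely needed: the Γ-field `ℚ(Γ(ℚτ + ℚc))` is
generated over `ℚ^{ab}(τ)` and is in general not regular over an algebraically closed subfield,
so — unlike Prop. 11.2 over a Γ-closed base (`ZilberProp112.lean`), where the function-field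
Kummer theory of `RadicalDenominators.lean` suffices — the embedding of the logarithm of an
element algebraic over `ℚ(Γ(A))` requires Kummer theory over `ℚ^{ab}`-extensions.

The proof follows the printed one (p. 26) in the organisation of `GammaField.corestep`
(`ZilberProp112.lean`): after extracting a basis `u` of `B = ℚτ + ℚc + ℚe` over `A = ℚτ + ℚc`,
an induction on the length of `u`:

* **Case 1a** (some `x ∈ B ∖ A` algebraic over `ℚ(Γ(A))`): the algebraic step
  `GammaField.IsGammaIso.exists_append_single_of_mem_acl` (`GammaIsoAlgebraicStep.lean`, any base);
* **Case 1b** (some `x ∈ B ∖ A` with `exp x` algebraic over `ℚ(Γ(A))`): the logarithmic step over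
  `ℚτ`, `ZilberSaturationLog.exists_append_single_of_exp_mem_acl` — NEW here: the Kummer fact
  supplies a division point `x/m` below which division sequences are determined, a logarithm
  `x₀` of a root of the transported minimal polynomial of `exp (x/m)` is a *generic partner*
  (`ZilberSaturationLog.exists_log_partner`, `ZilberSaturationLog.isGenericPt_idealMapCoeff`:
  transport of relation ideals of `(a₀, y)` with `y` algebraic and `a₀` transcendental over
  `E(y)`), and the embedding of Γ-fields is assembled by
  `ZilberSaturationMain.exists_ringHom_isoCore` exactly as in the free case;
* **Case 2** (no such `x`: the locus of `u` over `ℚ(Γ(A))` is free, "`A = A^full ∧ B`"): the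
  main case `ZilberSaturationMain.exists_isGammaIso_append_of_free`
  (`ZilberFieldSaturationMain.lean`: good basis, axiom 4, genericity, Kummer).

Strongness of the new subspaces is Lemma 4.8 (`δ = 0` over a strong subspace) throughout; the
Schanuel property and the transcendence of `τ` (beyond `τ ≠ 0`) are not used.

## References (Part II)

* M. Bays, J. Kirby, *Pseudo-exponential maps, variants, and quasiminimality*, Algebra & Number
  Theory 12 (2018) 493–549, arXiv:1512.04262: Prop. 3.22, Lemma 4.8, §4.4 (Thm 4.17),
  Lemma 8.3, Thm 9.1.
-/

noncomputable section

open Set MvPolynomial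

universe u

namespace Literature.NumberTheory.Transcendental

namespace ZilberSaturationLog

open GammaField Literature.ModelTheory.ExponentialFields.ExponentialRing ZilberHomogeneity
  ZilberSaturationMain

/-! ### Transport of relation ideals along an isomorphism of coefficient fields -/

section GenTransport

variable {F : Type*} [Field F] {E E' : Type*} [Field E] [Field E'] [Algebra E F] [Algebra E' F]
  (θ : E ≃+* E')

/-- **Univariate transport of vanishing.** If `y` is integral over `E` and `w` is a root of the
image under `θ : E ≅ E'` of its minimal polynomial, then a polynomial over `E` vanishes at `y`
iff its `θ`-image vanishes at `w` (`θ(minpoly y)` is the minimal polynomial of `w`). [folklore] -/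
theorem aeval_eq_zero_iff_aeval_map_eq_zero {y w : F} (hyi : IsIntegral E y)
    (hw : Polynomial.eval₂ ((algebraMap E' F).comp (θ : E →+* E')) w (minpoly E y) = 0)
    (s : Polynomial E) :
    Polynomial.aeval y s = 0 ↔ Polynomial.aeval w (s.map (θ : E →+* E')) = 0 := by
  have hqirr : Irreducible (minpoly E y) := minpoly.irreducible hyi
  have hqm : (minpoly E y).Monic := minpoly.monic hyi
  have hmap : ∀ p : Polynomial E, p.map (θ : E →+* E') = Polynomial.mapEquiv θ p := fun p =>
    (Polynomial.mapEquiv_apply θ p).symm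
  have hγ : minpoly E' w = (minpoly E y).map (θ : E →+* E') := by
    symm
    refine minpoly.eq_of_irreducible_of_monic ?_ ?_ (hqm.map _)
    · rw [hmap]
      exact (MulEquiv.irreducible_iff (Polynomial.mapEquiv θ)).2 hqirr
    · rw [Polynomial.aeval_def, Polynomial.eval₂_map]
      exact hw
  rw [← minpoly.dvd_iff, ← minpoly.dvd_iff, hγ, hmap, hmap, map_dvd_iff]

/-- Evaluation of a polynomial in one `MvPolynomial` variable through the univariate polynomial
ring. [folklore] -/
theorem aeval_single_eq (y : F) (r : MvPolynomial (Fin 1) E) :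
    aeval ![y] r =
      Polynomial.aeval y (aeval (fun _ : Fin 1 => (Polynomial.X : Polynomial E)) r) := by
  have : (Polynomial.aeval y).comp (aeval fun _ : Fin 1 => (Polynomial.X : Polynomial E)) =
      aeval ![y] := by
    refine MvPolynomial.algHom_ext fun i => ?_
    simp [Fin.fin_one_eq_zero i]
  exact (congrArg (fun f => f r) this).symm

/-- The univariate presentation commutes with `θ`. [folklore] -/
theorem map_aeval_X_eq (r : MvPolynomial (Fin 1) E) :
    (aeval (fun _ : Fin 1 => (Polynomial.X : Polynomial E)) r).map (θ : E →+* E') =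
      aeval (fun _ : Fin 1 => (Polynomial.X : Polynomial E')) (MvPolynomial.map (θ : E →+* E') r) := by
  have : (Polynomial.mapRingHom (θ : E →+* E')).comp
        (aeval fun _ : Fin 1 => (Polynomial.X : Polynomial E)).toRingHom =
      (aeval fun _ : Fin 1 => (Polynomial.X : Polynomial E')).toRingHom.comp
        (MvPolynomial.map (θ : E →+* E')) := by
    refine MvPolynomial.ringHom_ext (fun e => ?_) (fun i => ?_)
    · simp [Polynomial.map_C]
    · simp
  exact congrArg (fun f => f r) this

/-- Transport of vanishing for polynomials in one `MvPolynomial` variable. [folklore] -/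
theorem aeval_single_eq_zero_iff_map {y w : F} (hyi : IsIntegral E y)
    (hw : Polynomial.eval₂ ((algebraMap E' F).comp (θ : E →+* E')) w (minpoly E y) = 0)
    (r : MvPolynomial (Fin 1) E) :
    aeval ![y] r = 0 ↔ aeval ![w] (MvPolynomial.map (θ : E →+* E') r) = 0 := by
  rw [aeval_single_eq, aeval_single_eq, ← map_aeval_X_eq]
  exact aeval_eq_zero_iff_aeval_map_eq_zero θ hyi hw _

omit [Algebra E F] [Algebra E' F] in
/-- `sumAlgEquiv` is natural in the coefficient ring. [folklore] -/
theorem sumAlgEquiv_map {κ ι : Type*} (P : MvPolynomial (κ ⊕ ι) E) :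
    sumAlgEquiv E' κ ι (MvPolynomial.map (θ : E →+* E') P) =
      MvPolynomial.map (MvPolynomial.map (θ : E →+* E')) (sumAlgEquiv E κ ι P) := by
  have : (sumAlgEquiv E' κ ι).toAlgHom.toRingHom.comp (MvPolynomial.map (θ : E →+* E')) =
      (MvPolynomial.map (MvPolynomial.map (θ : E →+* E'))).comp
        (sumAlgEquiv E κ ι).toAlgHom.toRingHom := by
    refine MvPolynomial.ringHom_ext (fun e => ?_) (fun s => ?_)
    · simp
    · rcases s with k | i
      · simp
      · simp
  exact congrArg (fun f => f P) this

/-- **Transport of the relation ideal of `(a₀, y)`.** Let `θ : E ≅ E'` be an isomorphism of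
coefficient fields inside `F`, `y` integral over `E`, `w` a root of `θ(minpoly y)`, `a₀`
transcendental over `E[y]` and `x₀` transcendental over `E'[w]`. Then a polynomial over `E`
vanishes at `(a₀, y)` iff its `θ`-image vanishes at `(x₀, w)`: both relation ideals are generated
by the minimal polynomials. [cite: BaysKirby2018ANT, §4.4 (Thm 4.17, proof)] -/
theorem aeval_sumElim_eq_zero_iff_map {y w a₀ x₀ : F} (hyi : IsIntegral E y)
    (hw : Polynomial.eval₂ ((algebraMap E' F).comp (θ : E →+* E')) w (minpoly E y) = 0)
    (ha : AlgebraicIndependent (Algebra.adjoin E (range ![y])) ![a₀])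
    (hx : AlgebraicIndependent (Algebra.adjoin E' (range ![w])) ![x₀])
    (g : MvPolynomial (Fin 1 ⊕ Fin 1) E) :
    aeval (Sum.elim ![a₀] ![y]) g = 0 ↔
      aeval (Sum.elim ![x₀] ![w]) (MvPolynomial.map (θ : E →+* E') g) = 0 := by
  rw [aeval_sumElim_eq_zero_iff ha, aeval_sumElim_eq_zero_iff hx, sumAlgEquiv_map]
  simp only [MvPolynomial.coeff_map]
  exact forall_congr' fun m => aeval_single_eq_zero_iff_map θ hyi hw _

/-- **Generic points transport along `θ`**: in the situation of `aeval_sumElim_eq_zero_iff_map`,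
`(x₀, w)` is a generic point of the `θ`-image of the relation ideal of `(a₀, y)` over `E`.
[cite: BaysKirby2018ANT, §4.4 (Thm 4.17, proof)] -/
theorem isGenericPt_idealMapCoeff {F : Type u} [Field F] {E E' : Type u} [Field E] [Field E']
    [Algebra E F] [Algebra E' F] (θ : E ≃+* E') {y w a₀ x₀ : F} (hyi : IsIntegral E y)
    (hw : Polynomial.eval₂ ((algebraMap E' F).comp (θ : E →+* E')) w (minpoly E y) = 0)
    (ha : AlgebraicIndependent (Algebra.adjoin E (range ![y])) ![a₀])
    (hx : AlgebraicIndependent (Algebra.adjoin E' (range ![w])) ![x₀]) :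
    IsGenericPt (LocusComponents.idealMapCoeff θ (locIdeal E (Sum.elim ![a₀] ![y])))
      (Sum.elim ![x₀] ![w]) := by
  intro f
  set g : MvPolynomial (Fin 1 ⊕ Fin 1) E := MvPolynomial.map (θ.symm : E' →+* E) f with hg
  have hfg : f = MvPolynomial.map (θ : E →+* E') g := by
    rw [hg, MvPolynomial.map_map]
    have : (θ : E →+* E').comp (θ.symm : E' →+* E) = RingHom.id E' := by
      ext e; simp
    rw [this, MvPolynomial.map_id]
  have h1 : aeval (Sum.elim ![x₀] ![w]) f = 0 ↔ aeval (Sum.elim ![a₀] ![y]) g = 0 := by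
    rw [hfg]; exact (aeval_sumElim_eq_zero_iff_map θ hyi hw ha hx g).symm
  rw [h1, isGenericPt_locIdeal E (Sum.elim ![a₀] ![y]) g, LocusComponents.idealMapCoeff,
    ← Ideal.comap_symm, Ideal.mem_comap]
  have h2 : (MvPolynomial.mapEquiv (Fin 1 ⊕ Fin 1) θ).symm f = g := by
    rw [hg, MvPolynomial.mapEquiv_symm, MvPolynomial.mapEquiv_apply]
  rw [h2]

end GenTransport

/-! ### The logarithmic partner -/

section LogPartner

variable {F : Type u} [Field F] [CharZero F] [Literature.ModelTheory.ExponentialFields.ExponentialRing F]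
variable {K : Submodule ℚ F} {N : ℕ} {c c' : Fin N → F}

omit [CharZero F] in
/-- `(a, exp a)` for a one-element tuple. [folklore] -/
theorem gammaPt_single (a : F) : gammaPt ![a] = Sum.elim ![a] ![exp a] := by
  funext s
  rcases s with i | i
  · simp [gammaPt]
  · simp [gammaPt, Fin.fin_one_eq_zero i]

omit [Literature.ModelTheory.ExponentialFields.ExponentialRing F] in
/-- An element outside `acl (insert y s)`, where `E ⊆ acl s`, is algebraically independent (as a
one-element family) over `E[y]`. [folklore] -/
theorem algebraicIndependent_single_adjoin {k : Type*} [Field k] [Algebra k F]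
    (E : IntermediateField k F) {s : Set F} (hE : (E : Set F) ⊆ acl s) {y a : F}
    (ha : a ∉ acl (insert y s)) :
    AlgebraicIndependent (Algebra.adjoin E (range ![y])) ![a] := by
  rw [algebraicIndependent_iff_transcendental]
  refine transcendental_of_not_mem_acl _ ?_ ha
  refine algebraAdjoin_subset_acl (fun r => acl_mono (subset_insert _ _) (hE r.2)) ?_
  rintro _ ⟨i, rfl⟩
  exact subset_acl _ (by simp [Fin.fin_one_eq_zero i])

/-- **The logarithmic partner.** Let `c ↦ c'` be a Γ-isomorphism over `K` between strong
subspaces `X = K + ℚc`, `X' = K + ℚc'` of the algebraically closed `F` with `exp` onto `Fˣ`, and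
suppose `ker exp ⊆ X`. If `a₀ ∉ X` has `exp a₀` algebraic over the Γ-field `⟨K c⟩`, then there is
`x₀ ∉ X'` with `exp x₀` algebraic over `⟨K c'⟩` such that `(x₀, exp x₀)` is a generic point of the
transport `θ(loc((a₀, exp a₀)/⟨K c⟩))` over `⟨K c'⟩`: take for `exp x₀` any root of the transported
minimal polynomial of `exp a₀` and for `x₀` any of its logarithms (`x₀ ∉ X'` because otherwise
`exp a₀ = exp v` for some `v ∈ X`, forcing `a₀ ∈ v + ker exp ⊆ X`; genericity because `a₀`, `x₀`
are transcendental over `⟨K c⟩(exp a₀)`, `⟨K c'⟩(exp x₀)` by strongness).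
[cite: BaysKirby2018ANT, §4.4 (Thm 4.17, proof), Lemma 8.3 (proof)] -/
theorem exists_log_partner [IsAlgClosed F] (hsurj : IsSurjectiveOntoUnits F)
    (hiso : IsGammaIso K c c') (hX : IsStrong (K ⊔ Submodule.span ℚ (range c)))
    (hX' : IsStrong (K ⊔ Submodule.span ℚ (range c')))
    (hker : ∀ z : F, exp z = 1 → z ∈ K ⊔ Submodule.span ℚ (range c))
    {a₀ : F} (hya : exp a₀ ∈ acl (gens (K ⊔ Submodule.span ℚ (range c))))
    (ha₀ : a₀ ∉ K ⊔ Submodule.span ℚ (range c)) :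
    ∃ x₀ : F, IsGenericPt (locusIdeal' K hiso ![a₀]) (gammaPt ![x₀]) ∧
      x₀ ∉ K ⊔ Submodule.span ℚ (range c') ∧
      exp x₀ ∈ acl (gens (K ⊔ Submodule.span ℚ (range c'))) := by
  classical
  set X := K ⊔ Submodule.span ℚ (range c) with hXdef
  set X' := K ⊔ Submodule.span ℚ (range c') with hX'def
  set E : IntermediateField (fieldOf K) F := bfld K c with hE
  set E' : IntermediateField (fieldOf K) F := bfld K c' with hE'
  set θ : E ≃+* E' := hiso.fieldEquiv with hθ
  set y : F := exp a₀ with hy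
  have hyi : IsIntegral E y := isIntegral_adjoinField_of_mem_acl hya
  set q : Polynomial E := minpoly E y with hq
  set q' : Polynomial E' := q.map (θ : E →+* E') with hq'
  have hqirr : Irreducible q := minpoly.irreducible hyi
  have hmapq : q' = Polynomial.mapEquiv θ q := (Polynomial.mapEquiv_apply θ q).symm
  have hq'irr : Irreducible q' := by
    rw [hmapq]; exact (MulEquiv.irreducible_iff (Polynomial.mapEquiv θ)).2 hqirr
  -- a root `w` of `θ(q)` in `F`
  have hdeg : (q'.map (algebraMap E' F)).degree ≠ 0 := by
    rw [Polynomial.degree_map]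
    exact (Polynomial.degree_pos_of_irreducible hq'irr).ne'
  obtain ⟨w, hwroot⟩ := IsAlgClosed.exists_root _ hdeg
  have hw : Polynomial.eval₂ ((algebraMap E' F).comp (θ : E →+* E')) w q = 0 := by
    rw [← Polynomial.eval₂_map, ← hq', ← Polynomial.eval_map]
    exact hwroot
  have hwq' : Polynomial.aeval w q' = 0 := by
    rw [Polynomial.aeval_def, hq', Polynomial.eval₂_map]; exact hw
  -- `w ≠ 0`
  have hw0 : w ≠ 0 := by
    intro hw0
    have h0 : q.coeff 0 ≠ 0 := minpoly.coeff_zero_ne_zero hyi (exp_ne_zero a₀)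
    have h1 : (q'.map (algebraMap E' F)).coeff 0 = 0 := by
      rw [Polynomial.coeff_zero_eq_eval_zero]
      rw [hw0] at hwroot
      exact hwroot
    rw [Polynomial.coeff_map, map_eq_zero, hq', Polynomial.coeff_map] at h1
    exact h0 ((map_eq_zero_iff _ θ.injective).1 h1)
  obtain ⟨x₀, hx₀⟩ := hsurj w hw0
  -- `w` is algebraic over `⟨K c'⟩`
  have hwalg : IsAlgebraic E' w := ⟨q', hq'irr.ne_zero, hwq'⟩
  have hwacl : w ∈ acl (gens X') := by
    rw [hX'def, ← acl_coe_adjoinField_eq K c']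
    exact mem_acl_coe_of_isAlgebraic E' hwalg
  -- `x₀ ∉ X'`
  have hx₀X' : x₀ ∉ X' := by
    intro hx₀X'
    have hwE' : exp x₀ ∈ E' := exp_mem_adjoinField_of_mem hx₀X'
    set v : F := hiso.symm.transport x₀ with hv
    have hvX : v ∈ X := hiso.symm.transport_mem hx₀X'
    -- `θ⁻¹ (exp x₀) = exp v`
    have hval : ((θ.symm ⟨exp x₀, hwE'⟩ : E) : F) = exp v := by
      rw [hθ, hiso.coe_fieldEquiv_symm_eq, hv]
      exact hiso.symm.coe_fieldEquiv_exp hx₀X' hwE'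
    -- `θ⁻¹ (exp x₀)` is a root of `q`
    have hroot' : q'.IsRoot ⟨exp x₀, hwE'⟩ := by
      have h0 : Polynomial.aeval (exp x₀) q' = 0 := by rw [hx₀]; exact hwq'
      have h1 : algebraMap E' F (Polynomial.aeval (⟨exp x₀, hwE'⟩ : E') q') = 0 := by
        rw [← Polynomial.aeval_algebraMap_apply F (⟨exp x₀, hwE'⟩ : E') q']; exact h0
      have h2 : Polynomial.aeval (⟨exp x₀, hwE'⟩ : E') q' = 0 :=
        (algebraMap E' F).injective (by rw [h1, map_zero])
      rwa [Polynomial.coe_aeval_eq_eval] at h2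
    have hqq' : q = q'.map (θ.symm : E' →+* E) := by
      rw [hq', Polynomial.map_map]
      have : (θ.symm : E' →+* E).comp (θ : E →+* E') = RingHom.id E := by
        ext e; simp
      rw [this, Polynomial.map_id]
    have hroot : q.IsRoot (θ.symm ⟨exp x₀, hwE'⟩) := by
      rw [Polynomial.IsRoot, hqq', Polynomial.eval_map, ← RingEquiv.coe_toRingHom, Polynomial.eval₂_hom,
        hroot'.eq_zero, map_zero]
    have hdeg1 : q.degree = 1 := Polynomial.degree_eq_one_of_irreducible_of_root hqirr hroot
    obtain ⟨e₁, he₁⟩ := minpoly.mem_range_of_degree_eq_one E y hdeg1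
    have hqe : q = Polynomial.X - Polynomial.C e₁ := by
      rw [hq, ← he₁]; exact minpoly.eq_X_sub_C (B := F) e₁
    have hr₀ : θ.symm ⟨exp x₀, hwE'⟩ = e₁ := by
      have := hroot
      rw [hqe, Polynomial.IsRoot, Polynomial.eval_sub, Polynomial.eval_X, Polynomial.eval_C,
        sub_eq_zero] at this
      exact this
    have hexp : exp a₀ = exp v := by
      rw [← hval, hr₀]; exact he₁.symm
    have hker' : a₀ - v ∈ X := by
      refine hker _ ?_
      rw [sub_eq_add_neg, exp_add, exp_neg_eq_inv, hexp, mul_inv_cancel₀ (exp_ne_zero v)]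
    exact ha₀ (by simpa using X.add_mem hker' hvX)
  refine ⟨x₀, ?_, hx₀X', hx₀ ▸ hwacl⟩
  -- genericity
  have ha : AlgebraicIndependent (Algebra.adjoin E (range ![y])) ![a₀] :=
    algebraicIndependent_single_adjoin E (coe_bfld_subset_acl K c)
      (not_mem_acl_of_exp_mem_acl hX hya ha₀)
  have hx : AlgebraicIndependent (Algebra.adjoin E' (range ![w])) ![x₀] := by
    refine algebraicIndependent_single_adjoin E' (coe_bfld_subset_acl K c') ?_
    rw [← hx₀]
    exact not_mem_acl_of_exp_mem_acl hX' (hx₀ ▸ hwacl) hx₀X'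
  have key := isGenericPt_idealMapCoeff θ hyi hw ha hx
  show IsGenericPt (LocusComponents.idealMapCoeff hiso.fieldEquiv
    (locIdeal (bfld K c) (gammaPt ![a₀]))) (gammaPt ![x₀])
  rw [gammaPt_single, gammaPt_single, hx₀]
  exact key

end LogPartner

/-! ### The logarithmic step over `ℚτ` -/

section LogStep

open Literature.FieldTheory.Kummer

variable {F : Type u} [Field F] [CharZero F] [Literature.ModelTheory.ExponentialFields.ExponentialRing F]

/-- The kernel `τℤ` lies in every subspace containing `τ`. [folklore] -/
theorem mem_of_exp_eq_one {τ : F} (hker : expKernel F = AddSubgroup.zmultiples τ)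
    {Λ : Submodule ℚ F} (hτΛ : τ ∈ Λ) {z : F} (hz : exp z = 1) : z ∈ Λ := by
  obtain ⟨j, rfl⟩ := exists_eq_zsmul_of_exp_eq_one hker hz
  exact Λ.smul_of_tower_mem j hτΛ

set_option maxHeartbeats 800000 in
set_option synthInstance.maxHeartbeats 200000 in
/-- **The logarithmic step over `ℚτ`** (Bays–Kirby 2018, proof of Lemma 8.3, the reduction
"`A^full ∧ B` embeds into `F` over `A`", logarithmic case, cf. §4.4, proof of Thm 4.17): let `F`
be algebraically closed with `exp` onto `Fˣ` and `ker exp = τℤ` (`τ ≠ 0`); let `ℚτ + ℚc ◁ F`,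
`ℚτ + ℚc' ◁ F`, `c ↦ c'` a Γ-isomorphism over `ℚτ`, and `d ∉ X = ℚτ + ℚc` with `exp d` algebraic
over `ℚ(Γ(X))`. Granted the Kummer fact
`Literature.FieldTheory.Kummer.BaysKirby2018_divisionSequences_determined` (Prop. 3.22: after
passing to a suitable division point `d/m`, all division sequences of `exp (d/m)` have the same
field type over `ℚ(Γ(X))(exp (d/m))`), there is `d' ∉ ℚτ + ℚc'` with `exp d'` algebraic over
`ℚ(Γ(ℚτ + ℚc'))` and `(c, d) ↦ (c', d')` a Γ-isomorphism over `ℚτ`: `exp (d'/m)` is a root of the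
transported minimal polynomial of `exp (d/m)` and `d'/m` one of its logarithms
(`exists_log_partner`), and the embedding of Γ-fields is assembled exactly as in the free case
(`ZilberSaturationMain.exists_ringHom_isoCore`). [cite: BaysKirby2018ANT, Lemma 8.3 (proof), Prop. 3.22, §4.4] -/
theorem exists_append_single_of_exp_mem_acl [IsAlgClosed F] (hsurj : IsSurjectiveOntoUnits F)
    {τ : F} (hker : expKernel F = AddSubgroup.zmultiples τ) (hτ : τ ≠ 0)
    (hKfact : BaysKirby2018_divisionSequences_determined.{u})
    {N : ℕ} {c c' : Fin N → F} {d : F}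
    (hX : IsStrong (Submodule.span ℚ {τ} ⊔ Submodule.span ℚ (range c)))
    (hX' : IsStrong (Submodule.span ℚ {τ} ⊔ Submodule.span ℚ (range c')))
    (hiso : IsGammaIso (Submodule.span ℚ {τ}) c c')
    (hd : exp d ∈ acl (gens (Submodule.span ℚ {τ} ⊔ Submodule.span ℚ (range c))))
    (hdX : d ∉ Submodule.span ℚ {τ} ⊔ Submodule.span ℚ (range c)) :
    ∃ d' : F, exp d' ∈ acl (gens (Submodule.span ℚ {τ} ⊔ Submodule.span ℚ (range c'))) ∧
      d' ∉ Submodule.span ℚ {τ} ⊔ Submodule.span ℚ (range c') ∧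
      IsGammaIso (Submodule.span ℚ {τ}) (Fin.append c ![d]) (Fin.append c' ![d']) := by
  classical
  set Λ₀ : Submodule ℚ F := Submodule.span ℚ {τ} with hΛ₀
  set X := Λ₀ ⊔ Submodule.span ℚ (range c) with hXdef
  set X' := Λ₀ ⊔ Submodule.span ℚ (range c') with hX'def
  set e : Fin 1 → F := ![d] with hedef
  have hτΛ₀ : τ ∈ Λ₀ := Submodule.subset_span rfl
  have hτX : τ ∈ X := Submodule.mem_sup_left hτΛ₀
  have hkerX : ∀ z : F, exp z = 1 → z ∈ X := fun z hz => mem_of_exp_eq_one hker hτX hz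
  -- Step 1: a basis `u = c ∘ σ` of `X` modulo `ℚτ`
  obtain ⟨r, σ, hu, hspan⟩ := exists_linIndepOver_comp Λ₀ c
  set u : Fin r → F := c ∘ σ with hudef
  have hXu : X = Λ₀ ⊔ Submodule.span ℚ (range u) := by rw [hXdef, ← hspan]
  -- Step 2: the Kummer fact
  set S : Set F := {τ} ∪ range c ∪ range e with hSdef
  have hSfin : S.Finite := ((finite_singleton τ).union (finite_range c)).union (finite_range e)
  set b : Fin r → F := fun l => exp (u l) with hbdef
  set cK : Fin 1 → F := fun j => exp (e j) with hcK
  have hb0 : ∀ l, b l ≠ 0 := fun l => exp_ne_zero _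
  have hc0 : ∀ j, cK j ≠ 0 := fun j => exp_ne_zero _
  have hue : LinIndepOver Λ₀ (Fin.append u e) := hu.append_single (by rwa [← hXu])
  have hind : MulIndepModTorsion (Fin.append b cK) := by
    have : Fin.append b cK = fun i => exp (Fin.append u e i) := by
      rw [comp_append]; rfl
    rw [this]
    exact mulIndepModTorsion_exp hker hue
  obtain ⟨m, hm, H⟩ := hKfact S hSfin b cK hb0 hc0 hind
  -- Step 3: the rescaled element `a = d / m`
  have hm0 : (m : F) ≠ 0 := Nat.cast_ne_zero.2 hm.ne'
  set a : Fin 1 → F := fun j => e j / (m : F) with hadef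
  have hea : ∀ j, (m : F) * a j = e j := fun j => by simp only [hadef]; field_simp
  have hea' : (fun j => (m : F) * a j) = e := funext hea
  have ha_single : a = ![d / (m : F)] := by
    funext j
    rw [Fin.fin_one_eq_zero j]
    simp [hadef, hedef]
  have hKum : KummerConclusion a S b := by
    intro ρ hρ Ω₂ _ _ σσ hσσ
    exact H (expTuple a) (fun j => by
      change exp (a j) ^ m = exp (e j)
      rw [← exp_nsmul, nsmul_eq_mul, hea]) ρ hρ Ω₂ σσ hσσ
  -- Step 4: the logarithmic partner on the `c'` side
  have hya : exp (d / (m : F)) ∈ acl (gens X) := by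
    refine mem_acl_of_pow_mem hm.ne' ?_
    rwa [← exp_nsmul, nsmul_eq_mul, mul_div_cancel₀ _ hm0]
  have ha₀ : d / (m : F) ∉ X := by
    intro h
    apply hdX
    have := X.smul_of_tower_mem m h
    rwa [nsmul_eq_mul, mul_div_cancel₀ _ hm0] at this
  obtain ⟨x₀, hgen₀, hx₀X', hx₀acl⟩ := exists_log_partner hsurj hiso hX hX' hkerX hya ha₀
  set x : Fin 1 → F := ![x₀] with hxdef
  have hgen : IsGenericPt (locusIdeal' Λ₀ hiso a) (gammaPt x) := by
    rw [ha_single]; exact hgen₀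
  -- Step 5: the isomorphism step
  set kk : IntermediateField (fieldOf Λ₀) F := bfld Λ₀ c with hkk
  set kk' : IntermediateField (fieldOf Λ₀) F := bfld Λ₀ c' with hkk'
  set θ := hiso.fieldEquiv with hθ
  have hfX_R : ∀ y ∈ fieldOf X, y ∈ Rfld kk (gammaPt a) := fun y hy =>
    algebraMap_mem_Rfld kk (gammaPt a) ⟨y, (mem_adjoinField_allGens_iff Λ₀ c).2 hy⟩
  have hrootsL : ∀ (d : ℕ), 0 < d → exp (τ / (d : F)) ∈ Lb a S b := by
    intro d hd
    refine Literature.FieldTheory.Kummer.mem_baseField_of_mem_allRoots_one _ ⟨d, hd, ?_⟩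
    rw [← exp_nsmul, nsmul_eq_mul, mul_div_cancel₀ _ (Nat.cast_ne_zero.2 hd.ne'), exp_tau_eq_one hker]
  have hurootsL : ∀ (l : Fin r) (d : ℕ), 0 < d → exp (u l / (d : F)) ∈ Lb a S b := by
    intro l d hd
    refine Literature.FieldTheory.Kummer.mem_baseField_of_mem_allRoots _ l ⟨d, hd, ?_⟩
    rw [← exp_nsmul, nsmul_eq_mul, mul_div_cancel₀ _ (Nat.cast_ne_zero.2 hd.ne')]
  have hexpX_L : ∀ y ∈ X, exp y ∈ Lb a S b := by
    intro y hy
    rw [hXu] at hy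
    obtain ⟨y₀, hy₀, y₁, hy₁, rfl⟩ := Submodule.mem_sup.1 hy
    rw [exp_add]
    refine mul_mem ?_ (exp_mem_of_mem_span hurootsL hy₁)
    rw [hΛ₀] at hy₀
    have hy₀' : y₀ ∈ Submodule.span ℚ (range ![τ]) := by simpa using hy₀
    exact exp_mem_of_mem_span (w := ![τ]) (fun i d hd => by simpa using hrootsL d hd) hy₀'
  have hS_L : S ⊆ Lb a S b := fun y hy => Literature.FieldTheory.Kummer.mem_baseField_of_mem _ (Or.inl hy)
  have hX_L : (X : Set F) ⊆ Lb a S b := by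
    intro y hy
    have hy' : y ∈ Submodule.span ℚ ({τ} ∪ range c) := by
      rw [Submodule.span_union]; exact hy
    exact mem_subfield_of_mem_span (fun z hz => hS_L (Or.inl hz)) hy'
  have hgensX_L : gens X ⊆ Lb a S b := by
    rintro y (hy | ⟨v, hv, rfl⟩)
    · exact hX_L hy
    · exact hexpX_L v hv
  have hfX_L : ∀ y ∈ fieldOf X, y ∈ Lb a S b := fun y hy =>
    fieldOf_subset_of_gens_subset hgensX_L hy
  have hLR : Lb a S b ≤ Rfld kk (gammaPt a) := by
    refine Subfield.closure_le.2 ?_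
    rintro y ((h1 | hS') | hbr)
    · -- roots of unity
      obtain ⟨v, hv, rfl⟩ := allRoots_one_subset hker hτ hτX h1
      exact hfX_R _ (exp_mem_fieldOf hv)
    · rcases hS' with hS'' | ⟨j, rfl⟩
      · rcases hS'' with (hτ' | ⟨i, rfl⟩) | ⟨j, rfl⟩
        · rw [mem_singleton_iff.1 hτ']
          exact hfX_R _ (mem_fieldOf_of_mem hτX)
        · exact hfX_R _ (mem_fieldOf_of_mem
            (Submodule.mem_sup_right (Submodule.subset_span ⟨i, rfl⟩)))
        · rw [← hea j]
          exact natCast_mul_mem_Rfld kk (gammaPt a) m (Sum.inl j)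
      · exact apply_mem_Rfld kk (gammaPt a) (Sum.inr j)
    · obtain ⟨l, hl⟩ := mem_iUnion.1 hbr
      obtain ⟨v, hv, rfl⟩ := allRoots_exp_subset hker hτ hτX
        (show u l ∈ X from by rw [hXu]; exact Submodule.mem_sup_right (Submodule.subset_span ⟨l, rfl⟩)) hl
      exact hfX_R _ (exp_mem_fieldOf hv)
  have hkkL : ∀ y : kk, algebraMap kk F y ∈ Lb a S b := fun y =>
    hfX_L _ ((mem_adjoinField_allGens_iff Λ₀ c).1 y.2)
  have heL : ∀ j, (m : F) * a j ∈ Lb a S b := fun j => by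
    rw [hea j]; exact hS_L (Or.inr ⟨j, rfl⟩)
  have hXkk : ∀ v ∈ X, ∃ y : kk, algebraMap kk F y = v := fun v hv =>
    ⟨⟨v, (mem_adjoinField_allGens_iff Λ₀ c).2 (mem_fieldOf_of_mem hv)⟩, rfl⟩
  have hexpXkk : ∀ v ∈ X, ∃ y : kk, algebraMap kk F y = exp v := fun v hv =>
    ⟨⟨exp v, (mem_adjoinField_allGens_iff Λ₀ c).2 (exp_mem_fieldOf hv)⟩, rfl⟩
  have hθexp : ∀ y₀ y₁ : kk, algebraMap kk F y₀ ∈ X →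
      algebraMap kk F y₁ = exp (algebraMap kk F y₀) →
      algebraMap kk' F (θ y₁) = exp (algebraMap kk' F (θ y₀)) := by
    rintro ⟨v₀, hv₀⟩ ⟨v₁, hv₁⟩ hy₀ hy₁
    change v₀ ∈ X at hy₀
    change v₁ = exp v₀ at hy₁
    subst hy₁
    exact (hiso.fieldEquiv_exp hy₀).2
  obtain ⟨D, Θ, hgensD, hΘkk, hΘe, hΘexp⟩ := exists_ringHom_isoCore θ hgen X hLR hX_L
    (by rintro _ ⟨v, hv, rfl⟩; exact hexpX_L v hv) hkkL heL hXkk hexpXkk hθexp hKum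
  rw [hea'] at hgensD hΘexp
  -- Step 6: the ring homomorphism on `⟨ℚτ, c, d⟩`
  set e' : Fin 1 → F := fun j => (m : F) * x j with he'
  have hY : Λ₀ ⊔ Submodule.span ℚ (range (Fin.append c e)) = X ⊔ Submodule.span ℚ (range e) := by
    rw [ZilberHomogeneity.range_append, Submodule.span_union, hXdef, sup_assoc]
  set E₂ : IntermediateField (fieldOf Λ₀) F :=
    IntermediateField.adjoin (fieldOf Λ₀) (allGens (Fin.append c e)) with hE₂
  have hE₂D : ∀ y ∈ E₂, y ∈ D := by
    intro y hy
    have hy' : y ∈ fieldOf (X ⊔ Submodule.span ℚ (range e)) := by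
      rw [← hY]; exact (mem_adjoinField_allGens_iff Λ₀ (Fin.append c e)).1 hy
    exact fieldOf_subset_of_gens_subset hgensD hy'
  let Θ' : E₂ →+* F :=
    { toFun := fun y => Θ ⟨y.1, hE₂D y.1 y.2⟩
      map_one' := Θ.map_one
      map_mul' := fun y y' => Θ.map_mul ⟨y.1, hE₂D y.1 y.2⟩ ⟨y'.1, hE₂D y'.1 y'.2⟩
      map_zero' := Θ.map_zero
      map_add' := fun y y' => Θ.map_add ⟨y.1, hE₂D y.1 y.2⟩ ⟨y'.1, hE₂D y'.1 y'.2⟩ }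
  have hΘ' : ∀ (y : F) (hy : y ∈ E₂), Θ' ⟨y, hy⟩ = Θ ⟨y, hE₂D y hy⟩ := fun _ _ => rfl
  have hΘ'kk : ∀ (y : F) (hy : y ∈ kk) (hy' : y ∈ E₂), Θ' ⟨y, hy'⟩ = (θ ⟨y, hy⟩ : F) := by
    intro y hy hy'
    rw [hΘ']
    exact hΘkk ⟨y, hy⟩ (hE₂D y hy')
  -- Step 7: the Γ-isomorphism
  have hisoY : IsGammaIso Λ₀ (Fin.append c e) (Fin.append c' e') := by
    refine isGammaIso_of_ringHom Θ' (fun κ => ?_) (fun i => ?_) (fun y hy => ?_)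
    · have hκ : (κ : F) ∈ kk := (bfld Λ₀ c).algebraMap_mem κ
      rw [hΘ'kk _ hκ]
      exact hiso.coe_fieldEquiv_algebraMap κ
    · induction i using Fin.addCases with
      | left i =>
        have hci : c i ∈ kk := mem_adjoinField_of_mem_adjoin
          (lvAlgebra_le_adjoin_allGens Λ₀ 0 c (lvGens_mem_lvAlgebra Λ₀ 0 c (Sum.inl i)))
        simp only [Fin.append_left]
        rw [hΘ'kk _ hci]
        have := hiso.coe_fieldEquiv_lvGens 0 (Sum.inl i)
        simpa using this
      | right j =>
        simp only [Fin.append_right]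
        rw [hΘ']
        have key : ∀ (h : e j ∈ D), Θ ⟨e j, h⟩ = (m : F) * x j := by
          intro h
          have h' : (m : F) * a j ∈ D := by rw [hea j]; exact h
          have hsub : (⟨e j, h⟩ : D) = ⟨(m : F) * a j, h'⟩ := Subtype.ext (hea j).symm
          rw [hsub]
          exact hΘe j h'
        exact key _
    · rw [hΘ', hΘ']
      rw [hY] at hy
      exact hΘexp y hy _ _
  -- Step 8: the output `d' = m x₀`
  refine ⟨(m : F) * x₀, ?_, ?_, ?_⟩
  · rw [← nsmul_eq_mul, exp_nsmul]
    have := zpow_mem_acl hx₀acl (m : ℤ)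
    rwa [zpow_natCast] at this
  · intro h
    apply hx₀X'
    have h1 : ((m : ℚ)⁻¹ : ℚ) • ((m : F) * x₀) ∈ X' := X'.smul_mem _ h
    have h2 : ((m : ℚ)⁻¹ : ℚ) • ((m : F) * x₀) = x₀ := by
      rw [← nsmul_eq_mul, ← Nat.cast_smul_eq_nsmul ℚ, smul_smul,
        inv_mul_cancel₀ (Nat.cast_ne_zero.2 hm.ne'), one_smul]
    rwa [h2] at h1
  · have he'eq : Fin.append c' e' = Fin.append c' ![(m : F) * x₀] := by
      congr 1
      funext j
      rw [Fin.fin_one_eq_zero j]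
      simp [he', hxdef]
    rw [← he'eq]
    exact hisoY

end LogStep

/-! ### The induction over `ℚτ` (Bays–Kirby 2018, Lemma 8.3, proof) -/

section Induction

open Literature.FieldTheory.Kummer

variable {F : Type u} [Field F] [CharZero F] [Literature.ModelTheory.ExponentialFields.ExponentialRing F]
variable {N n : ℕ}

set_option maxHeartbeats 400000 in
/-- **Case 1 of the induction over `ℚτ`.** If some `x ∈ B ∖ A` (`A = ℚτ + ℚc`, `B = A + ℚu`) is
algebraic over `Γ(A)` or has `exp x` algebraic over `Γ(A)`, the Γ-isomorphism `c ↦ c'` over `ℚτ`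
extends by `x` (`GammaField.IsGammaIso.exists_append_single_of_mem_acl`, resp. the logarithmic
step `exists_append_single_of_exp_mem_acl`, which uses the Kummer fact), the new bases are strong
(Lemma 4.8) and `B` has a basis over `A + ℚx` of smaller length with `δ = 0`
(the bookkeeping of `GammaField.exists_case1_reduct`). [cite: BaysKirby2018ANT, Lemma 8.3 (proof), Lemma 4.8, §4.4] -/
theorem exists_case1_reduct [IsAlgClosed F] (hsurj : IsSurjectiveOntoUnits F)
    {τ : F} (hker : expKernel F = AddSubgroup.zmultiples τ) (hτ : τ ≠ 0)
    (hKfact : BaysKirby2018_divisionSequences_determined.{u})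
    {c c' : Fin N → F} (hiso : IsGammaIso (Submodule.span ℚ {τ}) c c')
    (hs : IsStrong (Submodule.span ℚ {τ} ⊔ Submodule.span ℚ (range c)))
    (hs' : IsStrong (Submodule.span ℚ {τ} ⊔ Submodule.span ℚ (range c'))) {u : Fin n → F}
    (hu : LinIndepOver (Submodule.span ℚ {τ} ⊔ Submodule.span ℚ (range c)) u)
    (htd : td (Submodule.span ℚ {τ} ⊔ Submodule.span ℚ (range c)) (Submodule.span ℚ (range u)) = n)
    {x : F}
    (hxB : x ∈ (Submodule.span ℚ {τ} ⊔ Submodule.span ℚ (range c)) ⊔ Submodule.span ℚ (range u))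
    (hxA : x ∉ Submodule.span ℚ {τ} ⊔ Submodule.span ℚ (range c))
    (hx : x ∈ acl (gens (Submodule.span ℚ {τ} ⊔ Submodule.span ℚ (range c))) ∨
      exp x ∈ acl (gens (Submodule.span ℚ {τ} ⊔ Submodule.span ℚ (range c)))) :
    ∃ (x' : F) (n₁ : ℕ) (u₁ : Fin n₁ → F), n₁ < n ∧
      IsGammaIso (Submodule.span ℚ {τ}) (Fin.append c ![x]) (Fin.append c' ![x']) ∧
      IsStrong (Submodule.span ℚ {τ} ⊔ Submodule.span ℚ (range (Fin.append c ![x]))) ∧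
      IsStrong (Submodule.span ℚ {τ} ⊔ Submodule.span ℚ (range (Fin.append c' ![x']))) ∧
      LinIndepOver (Submodule.span ℚ {τ} ⊔ Submodule.span ℚ (range (Fin.append c ![x]))) u₁ ∧
      td (Submodule.span ℚ {τ} ⊔ Submodule.span ℚ (range (Fin.append c ![x])))
        (Submodule.span ℚ (range u₁)) = n₁ ∧
      (∀ j, u₁ j ∈ (Submodule.span ℚ {τ} ⊔ Submodule.span ℚ (range c)) ⊔ Submodule.span ℚ (range u)) ∧
      (∀ j, u j ∈ (Submodule.span ℚ {τ} ⊔ Submodule.span ℚ (range (Fin.append c ![x]))) ⊔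
        Submodule.span ℚ (range u₁)) := by
  classical
  set K : Submodule ℚ F := Submodule.span ℚ {τ} with hKdef
  -- the one-step extension and the strongness of the new bases
  have hstep : ∃ x' : F, IsGammaIso K (Fin.append c ![x]) (Fin.append c' ![x']) ∧
      IsStrong (K ⊔ Submodule.span ℚ (range (Fin.append c' ![x']))) := by
    rcases hx with hx | hx
    · obtain ⟨x', hx'acl, hx'A, hγ⟩ := hiso.exists_append_single_of_mem_acl hs hs' hx hxA
      refine ⟨x', hγ, ?_⟩
      rw [sup_span_range_append_single]
      exact isStrong_sup_span_singleton_of_mem_acl hs' hx'acl hx'A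
    · obtain ⟨x', hx'acl, hx'A, hγ⟩ :=
        exists_append_single_of_exp_mem_acl hsurj hker hτ hKfact hs hs' hiso hx hxA
      refine ⟨x', hγ, ?_⟩
      rw [sup_span_range_append_single]
      exact isStrong_sup_span_singleton_of_exp_mem_acl hs' hx'acl hx'A
  obtain ⟨x', hγ, hs₁'⟩ := hstep
  have hA₁ : K ⊔ Submodule.span ℚ (range (Fin.append c ![x])) =
      (K ⊔ Submodule.span ℚ (range c)) ⊔ Submodule.span ℚ {x} := sup_span_range_append_single K c x
  have htd1 : td (K ⊔ Submodule.span ℚ (range c)) (Submodule.span ℚ {x}) ≤ 1 := by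
    rcases hx with hx | hx
    · exact td_span_singleton_le_one_of_mem_acl hx
    · exact td_span_singleton_le_one_of_exp_mem_acl hx
  have hδx : predim (K ⊔ Submodule.span ℚ (range c)) (Submodule.span ℚ {x}) = 0 :=
    (td_eq_one_and_predim_eq_zero_of_td_le_one hs hxA htd1).2
  have hs₁ : IsStrong (K ⊔ Submodule.span ℚ (range (Fin.append c ![x]))) := by
    rw [hA₁]
    exact hs.of_predim_eq_zero le_sup_left (isFG_sup_left.2 (isFG_span_of_finite _ (finite_singleton x)))
      (by rwa [predim_sup_left])
  -- a basis of `B` over `A + ℚx`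
  obtain ⟨n₁, σ, hu₁, hu₁span⟩ := exists_linIndepOver_comp (K ⊔ Submodule.span ℚ (range (Fin.append c ![x]))) u
  have hBeq : (K ⊔ Submodule.span ℚ (range (Fin.append c ![x]))) ⊔ Submodule.span ℚ (range u) =
      (K ⊔ Submodule.span ℚ (range c)) ⊔ Submodule.span ℚ (range u) := by
    rw [hA₁]
    refine le_antisymm (sup_le (sup_le le_sup_left ((Submodule.span_singleton_le_iff_mem _ _).2 hxB)) le_sup_right) ?_
    exact sup_le (le_sup_left.trans le_sup_left) le_sup_right
  -- dimensions
  have hfgu : IsFG (K ⊔ Submodule.span ℚ (range c)) (Submodule.span ℚ (range u)) :=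
    isFG_span_of_finite _ (finite_range u)
  have hfgB : IsFG (K ⊔ Submodule.span ℚ (range c))
      ((K ⊔ Submodule.span ℚ (range (Fin.append c ![x]))) ⊔ Submodule.span ℚ (range u)) := by
    rw [hBeq]; exact isFG_sup_left.2 hfgu
  have hle₁ : K ⊔ Submodule.span ℚ (range c) ≤ K ⊔ Submodule.span ℚ (range (Fin.append c ![x])) := by
    rw [hA₁]; exact le_sup_left
  have hldim := ldim_add hle₁ (le_sup_left : K ⊔ Submodule.span ℚ (range (Fin.append c ![x])) ≤
      (K ⊔ Submodule.span ℚ (range (Fin.append c ![x]))) ⊔ Submodule.span ℚ (range u)) hfgB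
  have hl1 : ldim (K ⊔ Submodule.span ℚ (range c)) (K ⊔ Submodule.span ℚ (range (Fin.append c ![x]))) = 1 := by
    rw [hA₁, ldim_sup_left, ldim_span_singleton_of_not_mem hxA]
  have hl2 : ldim (K ⊔ Submodule.span ℚ (range (Fin.append c ![x])))
      ((K ⊔ Submodule.span ℚ (range (Fin.append c ![x]))) ⊔ Submodule.span ℚ (range u)) = n₁ := by
    rw [← hu₁span, ldim_sup_left, ldim_span_eq_of_linIndepOver hu₁]
  have hl3 : ldim (K ⊔ Submodule.span ℚ (range c))
      ((K ⊔ Submodule.span ℚ (range (Fin.append c ![x]))) ⊔ Submodule.span ℚ (range u)) = n := by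
    rw [hBeq, ldim_sup_left, ldim_span_eq_of_linIndepOver hu]
  rw [hl1, hl2, hl3] at hldim
  have hlt : n₁ < n := by omega
  have hδB : predim (K ⊔ Submodule.span ℚ (range c))
      ((K ⊔ Submodule.span ℚ (range (Fin.append c ![x]))) ⊔ Submodule.span ℚ (range u)) = 0 := by
    rw [hBeq, predim_sup_left, predim, htd, ldim_span_eq_of_linIndepOver hu]; simp
  have hpadd := predim_add hle₁ (le_sup_left : K ⊔ Submodule.span ℚ (range (Fin.append c ![x])) ≤
      (K ⊔ Submodule.span ℚ (range (Fin.append c ![x]))) ⊔ Submodule.span ℚ (range u)) hfgB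
  have hδ1 : predim (K ⊔ Submodule.span ℚ (range c)) (K ⊔ Submodule.span ℚ (range (Fin.append c ![x]))) = 0 := by
    rw [hA₁, predim_sup_left, hδx]
  rw [hδB, hδ1, zero_add] at hpadd
  have htd₁ : td (K ⊔ Submodule.span ℚ (range (Fin.append c ![x]))) (Submodule.span ℚ (range (u ∘ σ))) = n₁ := by
    have h0 : predim (K ⊔ Submodule.span ℚ (range (Fin.append c ![x]))) (Submodule.span ℚ (range (u ∘ σ))) = 0 := by
      rw [← predim_sup_left, hu₁span]
      exact hpadd.symm
    rw [predim, ldim_span_eq_of_linIndepOver hu₁] at h0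
    have hne : td (K ⊔ Submodule.span ℚ (range (Fin.append c ![x]))) (Submodule.span ℚ (range (u ∘ σ))) ≠ ⊤ :=
      td_ne_top (isFG_span_of_finite _ (finite_range _))
    rw [← ENat.coe_toNat hne]
    congr 1
    omega
  refine ⟨x', n₁, u ∘ σ, hlt, hγ, hs₁, hs₁', hu₁, htd₁, fun j => ?_, fun j => ?_⟩
  · exact Submodule.mem_sup_right (Submodule.subset_span ⟨σ j, rfl⟩)
  · rw [hu₁span]
    exact Submodule.mem_sup_right (Submodule.subset_span ⟨j, rfl⟩)

/-- **The core of Lemma 8.3 over `ℚτ`** (induction on the linear dimension of `B/A`, as in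
`GammaField.corestep` for Prop. 11.2): for a Γ-isomorphism `c ↦ c'` over `ℚτ` between strong
subspaces and a basis `u` of a Γ-algebraic extension of `ℚτ + ℚc`, there is a Γ-isomorphism
`T ↦ T'` over `ℚτ` whose domain span contains `c` and `u`, transporting `c ↦ c'`, with the
transport image of `ℚτ + ℚc + ℚu` strong in `F`. Case 1 (an element of `B ∖ A` algebraic over
`Γ(A)` or with algebraic exponential): `exists_case1_reduct` and recursion; Case 2 (no such
element, i.e. the locus of `u` is free — "`A = A^full ∧ B`"): the main case
`ZilberSaturationMain.exists_isGammaIso_append_of_free` (good basis, strong exponential-algebraic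
closedness, Kummer theory). [cite: BaysKirby2018ANT, Lemma 8.3 (proof)] -/
theorem corestep [IsAlgClosed F] (hsurj : IsSurjectiveOntoUnits F) (hSEAC : IsStronglyExpAlgClosed F)
    {τ : F} (hker : expKernel F = AddSubgroup.zmultiples τ) (hτ : τ ≠ 0)
    (hKfact : BaysKirby2018_divisionSequences_determined.{u}) :
    ∀ (n : ℕ) {N : ℕ} {c c' : Fin N → F} (_hiso : IsGammaIso (Submodule.span ℚ {τ}) c c')
      (_hs : IsStrong (Submodule.span ℚ {τ} ⊔ Submodule.span ℚ (range c)))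
      (_hs' : IsStrong (Submodule.span ℚ {τ} ⊔ Submodule.span ℚ (range c'))) {u : Fin n → F}
      (_hu : LinIndepOver (Submodule.span ℚ {τ} ⊔ Submodule.span ℚ (range c)) u)
      (_htd : td (Submodule.span ℚ {τ} ⊔ Submodule.span ℚ (range c)) (Submodule.span ℚ (range u)) = n),
      ∃ (m : ℕ) (T T' : Fin m → F) (H : IsGammaIso (Submodule.span ℚ {τ}) T T'),
        (∀ i, c i ∈ Submodule.span ℚ {τ} ⊔ Submodule.span ℚ (range T)) ∧
        (∀ j, u j ∈ Submodule.span ℚ {τ} ⊔ Submodule.span ℚ (range T)) ∧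
        (∀ i, H.transport (c i) = c' i) ∧
        IsStrong (Submodule.span ℚ {τ} ⊔ Submodule.span ℚ (range fun j => H.transport (Fin.append c u j))) := by
  intro n
  induction n using Nat.strong_induction_on with
  | _ n ih =>
    intro N c c' hiso hs hs' u hu htd
    classical
    set K : Submodule ℚ F := Submodule.span ℚ {τ} with hKdef
    by_cases h1 : ∃ x ∈ (K ⊔ Submodule.span ℚ (range c)) ⊔ Submodule.span ℚ (range u),
        x ∉ K ⊔ Submodule.span ℚ (range c) ∧
        (x ∈ acl (gens (K ⊔ Submodule.span ℚ (range c))) ∨ exp x ∈ acl (gens (K ⊔ Submodule.span ℚ (range c))))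
    · -- Case 1
      obtain ⟨x, hxB, hxA, hx⟩ := h1
      obtain ⟨x', n₁, u₁, hlt, hγ, hs₁, hs₁', hu₁, htd₁, hu₁B, huB₁⟩ :=
        exists_case1_reduct hsurj hker hτ hKfact hiso hs hs' hu htd hxB hxA hx
      obtain ⟨m, T, T', H, hcT, huT, hTc, hstr⟩ := ih n₁ hlt hγ hs₁ hs₁' hu₁ htd₁
      exact corestep_of_case1 hu₁B huB₁ hxB H hcT huT hTc hstr
    · -- Case 2: the locus of `u` is free
      push Not at h1
      have hfree : ∀ m : Fin n → ℤ, m ≠ 0 →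
          ∑ j, (m j : ℚ) • u j ∉ acl (gens (K ⊔ Submodule.span ℚ (range c))) ∧
          exp (∑ j, (m j : ℚ) • u j) ∉ acl (gens (K ⊔ Submodule.span ℚ (range c))) := by
        intro m hm
        have hmem : ∑ j, (m j : ℚ) • u j ∈ (K ⊔ Submodule.span ℚ (range c)) ⊔ Submodule.span ℚ (range u) :=
          Submodule.mem_sup_right (Submodule.sum_mem _ fun j _ =>
            Submodule.smul_mem _ _ (Submodule.subset_span ⟨j, rfl⟩))
        have hnot := hu.sum_intCast_smul_notMem hm
        exact ⟨fun h => ((h1 _ hmem hnot).1 h).elim, fun h => ((h1 _ hmem hnot).2 h).elim⟩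
      obtain ⟨g, hγ, hstrong'⟩ :=
        exists_isGammaIso_append_of_free hSEAC hker hτ hKfact hs hs' hiso hu htd hfree
      have hcT : ∀ i, c i ∈ K ⊔ Submodule.span ℚ (range (Fin.append c u)) := fun i =>
        Submodule.mem_sup_right (Submodule.subset_span ⟨Fin.castAdd n i, by simp⟩)
      have huT : ∀ j, u j ∈ K ⊔ Submodule.span ℚ (range (Fin.append c u)) := fun j =>
        Submodule.mem_sup_right (Submodule.subset_span ⟨Fin.natAdd N j, by simp⟩)
      refine ⟨N + n, Fin.append c u, Fin.append c' g, hγ, hcT, huT, fun i => ?_, ?_⟩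
      · have := hγ.transport_apply (Fin.castAdd n i)
        simpa only [Fin.append_left] using this
      · have : (fun j => hγ.transport (Fin.append c u j)) = Fin.append c' g :=
          funext fun j => hγ.transport_apply j
        rw [this]
        exact hstrong'

end Induction

end ZilberSaturationLog

/-! ### Lemma 8.3 over `ℚτ` from the Kummer fact -/

open GammaField Literature.ModelTheory.ExponentialFields.ExponentialRing ZilberSaturationMain
  ZilberSaturationLog Literature.FieldTheory.Kummer in
/-- **Bays–Kirby 2018, Lemma 8.3 (⟹) over `ℚτ`, from the Kummer fact.** Strong
exponential-algebraic closedness makes an algebraically closed exponential field with `exp` onto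
`Fˣ` and `ker exp = τℤ` `ℵ₀`-saturated for finitely generated Γ-algebraic strong extensions of
finitely generated strong subspaces `ℚτ + ℚc ◁ F` (the named fact
`Literature.NumberTheory.Transcendental.BaysKirby2018_saturation_of_isStronglyExpAlgClosed`), granted the Kummer-theoretic named fact
`Literature.FieldTheory.Kummer.BaysKirby2018_divisionSequences_determined` (Prop. 3.22/3.24, existence
of good bases; the printed proof uses it both for the good basis of `B` over `A^full ∧ B` and,
through the uniqueness of full closures, for the reduction to `A = A^full ∧ B`). Proof: extract a
basis `u` of `B = ℚτ + ℚc + ℚe` over `A = ℚτ + ℚc`, run the induction `ZilberSaturationLog.corestep`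
(absorbing algebraic elements and logarithms of algebraic elements one at a time, then the free
case by axiom 4), and transport `e` along the resulting Γ-isomorphism. The Schanuel property and
the transcendence of `τ` (beyond `τ ≠ 0`) are not used. [cite: BaysKirby2018ANT, Lemma 8.3, Prop. 3.22, Thm 9.1] -/
theorem BaysKirby2018_saturation_of_isStronglyExpAlgClosed_of_divisionSequences_determined
    (hKfact : BaysKirby2018_divisionSequences_determined.{u}) :
    BaysKirby2018_saturation_of_isStronglyExpAlgClosed.{u} := by
  intro F _ _ _ hF hsurj τ hτt hker _hSP hSEAC N k c c' e hs hs' hiso hδ _hse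
  classical
  haveI := hF
  set K : Submodule ℚ F := Submodule.span ℚ {τ} with hKdef
  have hτ : τ ≠ 0 := fun h => hτt (h ▸ isAlgebraic_zero)
  -- a basis of `B` over `A`
  obtain ⟨n, ρ, hu, hB⟩ := exists_linIndepOver_comp (K ⊔ Submodule.span ℚ (range c)) e
  have htd : td (K ⊔ Submodule.span ℚ (range c)) (Submodule.span ℚ (range (e ∘ ρ))) = n := by
    have hl : ldim (K ⊔ Submodule.span ℚ (range c)) (Submodule.span ℚ (range (e ∘ ρ))) = n :=
      ldim_span_eq_of_linIndepOver hu
    have hl' : ldim (K ⊔ Submodule.span ℚ (range c)) (Submodule.span ℚ (range e)) = n := by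
      rw [← ldim_sup_left, ← hB, ldim_sup_left, hl]
    have ht : td (K ⊔ Submodule.span ℚ (range c)) (Submodule.span ℚ (range (e ∘ ρ))) =
        td (K ⊔ Submodule.span ℚ (range c)) (Submodule.span ℚ (range e)) := by
      rw [← td_sup_left, hB, td_sup_left]
    have h0 : predim (K ⊔ Submodule.span ℚ (range c)) (Submodule.span ℚ (range e)) = 0 := hδ
    rw [predim, hl'] at h0
    rw [ht]
    have hne : td (K ⊔ Submodule.span ℚ (range c)) (Submodule.span ℚ (range e)) ≠ ⊤ :=
      td_ne_top (isFG_span_of_finite _ (finite_range e))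
    rw [← ENat.coe_toNat hne]
    congr 1
    omega
  obtain ⟨m, T, T', H, hcT, huT, hTc, hstrong⟩ :=
    ZilberSaturationLog.corestep hsurj hSEAC hker hτ hKfact n hiso hs hs' hu htd
  -- memberships
  have hA_le : K ⊔ Submodule.span ℚ (range c) ≤ K ⊔ Submodule.span ℚ (range T) := by
    refine sup_le le_sup_left (Submodule.span_le.2 ?_)
    rintro _ ⟨j, rfl⟩; exact hcT j
  have hle' : (K ⊔ Submodule.span ℚ (range c)) ⊔ Submodule.span ℚ (range (e ∘ ρ)) ≤
      K ⊔ Submodule.span ℚ (range T) := by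
    refine sup_le hA_le (Submodule.span_le.2 ?_)
    rintro _ ⟨i, rfl⟩; exact huT i
  have heT : ∀ j, e j ∈ K ⊔ Submodule.span ℚ (range T) := by
    intro j
    have : e j ∈ (K ⊔ Submodule.span ℚ (range c)) ⊔ Submodule.span ℚ (range e) :=
      Submodule.mem_sup_right (Submodule.subset_span ⟨j, rfl⟩)
    rw [← hB] at this
    exact hle' this
  have hy1 : ∀ j, Fin.append c e j ∈ K ⊔ Submodule.span ℚ (range T) := by
    intro j
    refine Fin.addCases (fun i => ?_) (fun i => ?_) j
    · simpa only [Fin.append_left] using hcT i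
    · simpa only [Fin.append_right] using heT i
  have hy2 : ∀ j, Fin.append c (e ∘ ρ) j ∈ K ⊔ Submodule.span ℚ (range T) := by
    intro j
    refine Fin.addCases (fun i => ?_) (fun i => ?_) j
    · simpa only [Fin.append_left] using hcT i
    · simpa only [Fin.append_right] using huT i
  refine ⟨fun j => H.transport (e j), ?_, ?_⟩
  · have := H.transfer (y := Fin.append c e) hy1
    rw [transport_append_eq] at this
    have heq : (fun i => H.transport (c i)) = c' := funext hTc
    rwa [heq] at this
  · have h1 : Fin.append c' (fun j => H.transport (e j)) = fun j => H.transport (Fin.append c e j) := by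
      rw [transport_append_eq]
      congr 1
      exact (funext hTc).symm
    have heq : K ⊔ Submodule.span ℚ (range (Fin.append c e)) =
        K ⊔ Submodule.span ℚ (range (Fin.append c (e ∘ ρ))) := by
      rw [ZilberHomogeneity.range_append, ZilberHomogeneity.range_append, Submodule.span_union,
        Submodule.span_union, ← sup_assoc, ← sup_assoc, hB]
    rw [h1, H.sup_span_transport_comp_eq hy1 hy2 heq]
    exact hstrong

end Literature.NumberTheory.Transcendental

end
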